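import Summits.ResolutionOfSingularities.ResolutionOfSingularities.Theorems.DescentDescentPerfectToAllSeparablyGenerated
import HarnessLib

/-!
# `DescentPerfectToAll` (stmt-ResolutionOfSingularities-0549): the crux restated on countable ground fields that
# are NOT SEPARABLY GENERATED over a perfect subfield

Route `ResolutionOfSingularities/Descent`, crux `DescentPerfectToAll`. Helper (OURS; not a statement of any
manuscript; `--supports` the crux, does not close it).

`descentPerfectToAll_iff_residual` (`DescentDescentPerfectToAllExhaustion.lean`) restates the crux on countable fields
that are not «EFT-separably exhausted» (an ad-hoc name for the master class of the mechanism «model over a level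
essentially of finite type over a perfect field + separable ascent»). With
`exhaustedByEssFiniteType_of_separatingTranscendenceBasis` (`DescentDescentPerfectToAllSeparablyGenerated.lean`) the
residual acquires its classical name:

* `not_separablyGenerated_of_not_exhaustedByEssFiniteType` — a field that is not EFT-separably exhausted has NO
  separating transcendence basis over ANY perfect subfield (contrapositive of the theorem quoted).
* `descentPerfectToAll_iff_residual_notSeparablyGenerated` — **the crux `DescentPerfectToAll` (verbatim binder
  form of stmt-0549) is EQUIVALENT to: for every prime `p`, resolution over the perfect fields of characteristic `p`
  implies resolution over every COUNTABLE field of characteristic `p` that is NOT SEPARABLY GENERATED over any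
  perfect subfield** (no `P ≤ K` perfect and `B ⊆ K` with `p`-independent finite subfamilies and `K / P(B)`
  separable algebraic — Mac Lane 1939). Kernel inhabitants of that class: `𝔽_p((X))`-hulls
  (`exists_countable_field_not_exhaustedByEssFiniteType` with the first bullet).

So, given the antecedent `PerfectRes p` (e.g. from a perfect-field resolution theorem), the summit's remaining
content in characteristic `p` is resolution over inseparably generated countable ground fields; in finite
transcendence degree over the perfect core these are exactly the fields of `p`-rank below the transcendence degree
(`exhaustedByEssFiniteType_iff_exists_pIndependent_of_perfectCore`).

[cite: Matsumura1987, §26 Thm. 26.5–26.8; EGAIV2, Prop. 6.7.4] [folklore]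
-/

noncomputable section

set_option linter.dupNamespace false -- mandated namespace of this single-conjunct summit

open CategoryTheory CategoryTheory.Limits AlgebraicGeometry
open Literature.AlgebraicGeometry.Resolution

namespace Summit.ResolutionOfSingularities.ResolutionOfSingularities.Theorems

/-- **Not EFT-separably exhausted ⇒ not separably generated over any perfect subfield** (contrapositive of
`exhaustedByEssFiniteType_of_separatingTranscendenceBasis`). [folklore] -/
theorem not_separablyGenerated_of_not_exhaustedByEssFiniteType {p : ℕ} [Fact p.Prime] {K : Type} [Field K]
    [CharP K p]
    (hK : ¬ ∀ s : Finset K, ∃ (k₀ : Type) (_ : Field k₀) (_ : PerfectField k₀) (E : Subfield K)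
      (_ : Algebra k₀ E), Algebra.EssFiniteType k₀ E ∧ (↑s : Set K) ⊆ E ∧
        ∀ u : Finset K, LinearIndepOn E _root_.id (↑u : Set K) →
          LinearIndepOn E (fun y : K => y ^ p) (↑u : Set K)) :
    ¬ ∃ (P : Subfield K) (_ : ∀ x ∈ P, ∃ y ∈ P, y ^ p = x) (B : Set K)
      (_ : ∀ (n : ℕ) (t : Fin n → K), Function.Injective t → Set.range t ⊆ B →
        ∀ e : (Fin n → Fin p) → K, ∑ α, (∏ i, t i ^ (α i : ℕ)) * e α ^ p = 0 → ∀ α, e α = 0),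
      Algebra.IsSeparable (IntermediateField.adjoin P B) K := by
  rintro ⟨P, hP, B, hB, hsep⟩
  haveI := hsep
  exact hK (exhaustedByEssFiniteType_of_separatingTranscendenceBasis P hP B hB)

/-- **Where the crux `DescentPerfectToAll` lives, classically named.** The crux (left-hand side, verbatim binder
form of stmt-0549) is EQUIVALENT to its restriction to COUNTABLE ground fields that are NOT SEPARABLY GENERATED over
any perfect subfield: no perfect `P ≤ k` and `B ⊆ k` with `p`-independent finite subfamilies such that `k` is
separable algebraic over `P(B)`. (`→` is specialisation; `←` combines `descentPerfectToAll_iff_residual` with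
`exhaustedByEssFiniteType_of_separatingTranscendenceBasis`.) [folklore] -/
theorem descentPerfectToAll_iff_residual_notSeparablyGenerated :
    (∀ p : ℕ, p.Prime → (∀ (κ : Type) [Field κ] [CharP κ p] [PerfectField κ] (Z : Scheme.{0})
      (g : Z ⟶ Spec (.of κ)), IsSeparated g → LocallyOfFiniteType g → QuasiCompact g →
        IsReduced Z → Scheme.HasResolution Z) →
      ∀ (k : Type) [Field k] [CharP k p] (X : Scheme.{0}) (f : X ⟶ Spec (.of k)),
        IsSeparated f → LocallyOfFiniteType f → QuasiCompact f → IsReduced X →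
          Scheme.HasResolution X) ↔
    (∀ p : ℕ, p.Prime → (∀ (κ : Type) [Field κ] [CharP κ p] [PerfectField κ] (Z : Scheme.{0})
      (g : Z ⟶ Spec (.of κ)), IsSeparated g → LocallyOfFiniteType g → QuasiCompact g →
        IsReduced Z → Scheme.HasResolution Z) →
      ∀ (k : Type) [Field k] [CharP k p], Countable k →
        (¬ ∃ (P : Subfield k) (_ : ∀ x ∈ P, ∃ y ∈ P, y ^ p = x) (B : Set k)
          (_ : ∀ (n : ℕ) (t : Fin n → k), Function.Injective t → Set.range t ⊆ B →
            ∀ e : (Fin n → Fin p) → k, ∑ α, (∏ i, t i ^ (α i : ℕ)) * e α ^ p = 0 → ∀ α, e α = 0),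
          Algebra.IsSeparable (IntermediateField.adjoin P B) k) →
        ∀ (X : Scheme.{0}) (f : X ⟶ Spec (.of k)), IsSeparated f → LocallyOfFiniteType f →
          QuasiCompact f → IsReduced X → Scheme.HasResolution X) := by
  constructor
  · intro h p hp H k _ _ _ _ X f a b c d
    exact h p hp H k X f a b c d
  · intro h
    refine descentPerfectToAll_iff_residual.mpr fun p hp H k _ _ hk hne X f a b c d => ?_
    haveI : Fact p.Prime := ⟨hp⟩
    exact h p hp H k hk (not_separablyGenerated_of_not_exhaustedByEssFiniteType hne) X f a b c d

end Summit.ResolutionOfSingularities.ResolutionOfSingularities.Theorems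

end
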